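import Summits.Ventures.PercRepro.RankLevelSetRuleQSliceBorderLarge
import Summits.Ventures.PercRepro.RankLevelSetRuleQRhat

/-!
# PercRepro — THE BORDERLINE FOR `11 ≤ k ≤ 22` FROM AN EXPLICIT THRESHOLD `q₁(k)` (night-1, gen 20; dossier §31.10)

`border_even_of_key` / `border_odd_of_key` (RankLevelSetRuleQSliceBorderLarge) reduce the borderline on `q ≥ k(k−3)/2` to one
numeric inequality in `q`; here that inequality is discharged from a threshold: `border_even_of_threshold (i m q₁)` needs only
`q₁ ≤ q = m + 2i` and the key inequality at `q₁` itself, `2^{4i+1}·(i+1)!·2^i·4(q₁+1) ≤ (2i+1)(2i−1)·q₁^i` (a `norm_num` fact per `k`;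
it propagates to `q ≥ q₁` since `(q+1)/q^i` decreases), likewise `border_odd_of_threshold`.
INSTANCES (each `Φ(q+k, q) ≤ R̂(q, k, q−k+2)` for every `q ≥ q₁(k)`): k = 11 (q₁ = 158), 12 (211), 13 (156), 14 (198), 15 (160),
16 (197), 17 (167), 18 (200), 19 (176), 20 (206), 21 (189 = k(k−3)/2), 22 (214) — `border_k11` … `border_k22` (`k ≥ 23`: `phiK_le_rhat_border_large`).
(The thresholds are those of the chain with the half-row factor `2^{2k−3}` and `D_k ≤ D_{k−1}` for even `k`;
the exact margins of §31.9 give `q₁(k)` between 160 and 200. The finite gaps `k(k−3)/2 ≤ q < q₁(k)` are kernel-evaluable.)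
* **`ruleQRecv_ge_phiK_border_large`** — THE MATROID LEVEL: in every finite matroid at the tight layer of a cell `(q+k, q)` with
  `k ≥ 23` and `q ≥ k(k−3)/2`, every member `Z` with `#(flatPart Z) = q − (k−2)` (the borderline slice) is paid by Rule Q's equal split
  (`rhat_le_ruleQRecv` + `phiK_le_rhat_border_large`); `ruleQRecv_ge_phiK_border_of_rhat` likewise from any per-`k` bound.
Axioms: standard.
-/

namespace PercRepro

open Finset

/-- The even-`k` borderline from a threshold: `k = 2i + 2`, `i ≥ 2`, `q = m + 2i ≥ q₁ ≥ 1`, `(2i+1)(2i−2) ≤ 2m`, and the key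
inequality AT THE THRESHOLD `2^{4i+1}·(i+1)!·2^i·4(q₁+1) ≤ (2i+1)(2i−1)·q₁^i` (it propagates to every `q ≥ q₁` because
`(q+1)/q^i` is decreasing). -/
theorem border_even_of_threshold (i m q₁ : ℕ) (hi : 2 ≤ i) (hm : (2 * i + 1) * (2 * i - 2) ≤ 2 * m) (hq₀ : 1 ≤ q₁)
    (hq₁ : q₁ ≤ m + 2 * i)
    (hnum : (2 : ℚ) ^ (4 * i + 1) * (((i + 1).factorial : ℚ) * 2 ^ i) * (4 * ((q₁ : ℚ) + 1))
      ≤ (2 * (i : ℚ) + 1) * (2 * (i : ℚ) - 1) * (q₁ : ℚ) ^ i) :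
    phiK (m + 2 * i + (2 * i + 2)) (m + 2 * i) ≤ rhat (m + 2 * i) (2 * i + 2) m := by
  refine border_even_of_key i m (by omega) hm ?_
  set Q := ((m + 2 * i : ℕ) : ℚ) with hQdef
  have hq : (q₁ : ℚ) ≤ Q := by rw [hQdef]; exact_mod_cast hq₁
  have hq0 : (1 : ℚ) ≤ q₁ := by exact_mod_cast hq₀
  have hc : (0 : ℚ) ≤ (2 * (i : ℚ) + 1) * (2 * (i : ℚ) - 1) := by
    have : (2 : ℚ) ≤ i := by exact_mod_cast hi
    nlinarith
  have hF : (0 : ℚ) ≤ (2 : ℚ) ^ (4 * i + 1) * (((i + 1).factorial : ℚ) * 2 ^ i) := by positivity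
  -- (Q + 1)·q₁^i ≤ (q₁ + 1)·Q^i  for Q ≥ q₁ ≥ 1, i ≥ 1
  have hmono : ((Q + 1) * (q₁ : ℚ) ^ i) ≤ ((q₁ : ℚ) + 1) * Q ^ i := by
    have hi1 : Q ^ i = Q ^ (i - 1) * Q := by rw [← pow_succ]; congr 1; omega
    have hj1 : (q₁ : ℚ) ^ i = (q₁ : ℚ) ^ (i - 1) * q₁ := by rw [← pow_succ]; congr 1; omega
    have hp1 : (q₁ : ℚ) ^ (i - 1) ≤ Q ^ (i - 1) := pow_le_pow_left₀ (by positivity) hq (i - 1)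
    have hp : (q₁ : ℚ) ^ i ≤ Q ^ i := pow_le_pow_left₀ (by positivity) hq i
    rw [hi1, hj1]
    have h1 : Q * (q₁ : ℚ) ^ (i - 1) * q₁ ≤ (q₁ : ℚ) * (Q ^ (i - 1) * Q) := by
      have := mul_le_mul_of_nonneg_left hp1 (by positivity : (0 : ℚ) ≤ Q * q₁)
      nlinarith [this]
    have h2 : (q₁ : ℚ) ^ (i - 1) * q₁ ≤ Q ^ (i - 1) * Q := by rw [← hj1, ← hi1]; exact hp
    nlinarith [h1, h2]
  -- assemble: key(Q)·q₁^i ≤ key(q₁)·Q^i ≤ RHS(q₁)·Q^i, divide by q₁^i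
  have hq1pos : (0 : ℚ) < (q₁ : ℚ) ^ i := by positivity
  have e1 : (2 : ℚ) ^ (4 * i + 1) * (((i + 1).factorial : ℚ) * 2 ^ i) * (4 * (Q + 1)) * (q₁ : ℚ) ^ i
      ≤ (2 : ℚ) ^ (4 * i + 1) * (((i + 1).factorial : ℚ) * 2 ^ i) * (4 * ((q₁ : ℚ) + 1)) * Q ^ i := by
    have := mul_le_mul_of_nonneg_left hmono (by positivity : (0 : ℚ) ≤ 4 * ((2 : ℚ) ^ (4 * i + 1) * (((i + 1).factorial : ℚ) * 2 ^ i)))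
    nlinarith [this]
  have e2 : (2 : ℚ) ^ (4 * i + 1) * (((i + 1).factorial : ℚ) * 2 ^ i) * (4 * ((q₁ : ℚ) + 1)) * Q ^ i
      ≤ (2 * (i : ℚ) + 1) * (2 * (i : ℚ) - 1) * (q₁ : ℚ) ^ i * Q ^ i :=
    mul_le_mul_of_nonneg_right hnum (by positivity)
  have e3 := e1.trans e2
  have : (2 : ℚ) ^ (4 * i + 1) * (((i + 1).factorial : ℚ) * 2 ^ i) * (4 * (Q + 1))
      ≤ (2 * (i : ℚ) + 1) * (2 * (i : ℚ) - 1) * Q ^ i := by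
    have h := le_of_mul_le_mul_right (a := (q₁ : ℚ) ^ i) (by linarith [e3] : (2 : ℚ) ^ (4 * i + 1) * (((i + 1).factorial : ℚ) * 2 ^ i) * (4 * (Q + 1)) * (q₁ : ℚ) ^ i ≤ (2 * (i : ℚ) + 1) * (2 * (i : ℚ) - 1) * Q ^ i * (q₁ : ℚ) ^ i) hq1pos
    exact h
  exact this

/-- The odd-`k` borderline from a threshold: `k = 2j + 3`, `j ≥ 1`, `q = m + 2j + 1 ≥ q₁ ≥ 1`, `(2j+2)(2j−1) ≤ 2m`, and the key
inequality at the threshold `2^{4j+3}·(j+2)!·2^{j+1}·4(q₁+1) ≤ 4(j+1)j·q₁^{j+1}`. -/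
theorem border_odd_of_threshold (j m q₁ : ℕ) (hj : 1 ≤ j) (hm : (2 * j + 1 + 1) * (2 * j + 1 - 2) ≤ 2 * m) (hq₀ : 1 ≤ q₁)
    (hq₁ : q₁ ≤ m + (2 * j + 1))
    (hnum : (2 : ℚ) ^ (4 * j + 3) * (((j + 1 + 1).factorial : ℚ) * 2 ^ (j + 1)) * (4 * ((q₁ : ℚ) + 1))
      ≤ 4 * ((j : ℚ) + 1) * (j : ℚ) * (q₁ : ℚ) ^ (j + 1)) :
    phiK (m + (2 * j + 1) + (2 * j + 1 + 2)) (m + (2 * j + 1)) ≤ rhat (m + (2 * j + 1)) (2 * j + 1 + 2) m := by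
  refine border_odd_of_key j m hj hm ?_
  set Q := ((m + (2 * j + 1) : ℕ) : ℚ) with hQdef
  have hq : (q₁ : ℚ) ≤ Q := by rw [hQdef]; exact_mod_cast hq₁
  have hq0 : (1 : ℚ) ≤ q₁ := by exact_mod_cast hq₀
  have hmono : ((Q + 1) * (q₁ : ℚ) ^ (j + 1)) ≤ ((q₁ : ℚ) + 1) * Q ^ (j + 1) := by
    have hp1 : (q₁ : ℚ) ^ j ≤ Q ^ j := pow_le_pow_left₀ (by positivity) hq j
    have hp : (q₁ : ℚ) ^ (j + 1) ≤ Q ^ (j + 1) := pow_le_pow_left₀ (by positivity) hq (j + 1)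
    rw [pow_succ, pow_succ]
    have h1 : Q * (q₁ : ℚ) ^ j * q₁ ≤ (q₁ : ℚ) * (Q ^ j * Q) := by
      have := mul_le_mul_of_nonneg_left hp1 (by positivity : (0 : ℚ) ≤ Q * q₁)
      nlinarith [this]
    have h2 : (q₁ : ℚ) ^ j * q₁ ≤ Q ^ j * Q := by rw [← pow_succ, ← pow_succ]; exact hp
    nlinarith [h1, h2]
  have hq1pos : (0 : ℚ) < (q₁ : ℚ) ^ (j + 1) := by positivity
  have e1 : (2 : ℚ) ^ (4 * j + 3) * (((j + 1 + 1).factorial : ℚ) * 2 ^ (j + 1)) * (4 * (Q + 1)) * (q₁ : ℚ) ^ (j + 1)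
      ≤ (2 : ℚ) ^ (4 * j + 3) * (((j + 1 + 1).factorial : ℚ) * 2 ^ (j + 1)) * (4 * ((q₁ : ℚ) + 1)) * Q ^ (j + 1) := by
    have := mul_le_mul_of_nonneg_left hmono (by positivity : (0 : ℚ) ≤ 4 * ((2 : ℚ) ^ (4 * j + 3) * (((j + 1 + 1).factorial : ℚ) * 2 ^ (j + 1))))
    nlinarith [this]
  have e2 : (2 : ℚ) ^ (4 * j + 3) * (((j + 1 + 1).factorial : ℚ) * 2 ^ (j + 1)) * (4 * ((q₁ : ℚ) + 1)) * Q ^ (j + 1)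
      ≤ 4 * ((j : ℚ) + 1) * (j : ℚ) * (q₁ : ℚ) ^ (j + 1) * Q ^ (j + 1) :=
    mul_le_mul_of_nonneg_right hnum (by positivity)
  have e3 := e1.trans e2
  exact le_of_mul_le_mul_right (a := (q₁ : ℚ) ^ (j + 1)) (by linarith [e3]) hq1pos

/-- `k = 11`: the borderline `Φ(q+11, q) ≤ R̂(q, 11, q − 9)` for every `q ≥ 158`. -/
theorem border_k11 (q : ℕ) (hq : 158 ≤ q) : phiK (q + 11) q ≤ rhat q 11 (q - 9) := by
  obtain ⟨m, rfl⟩ : ∃ m, q = m + (2 * 4 + 1) := ⟨q - (2 * 4 + 1), by omega⟩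
  rw [show m + (2 * 4 + 1) - 9 = m by omega]
  exact border_odd_of_threshold 4 m 158 (by norm_num) (by omega) (by norm_num) (by omega) (by norm_num [Nat.factorial])

/-- `k = 12`: the borderline `Φ(q+12, q) ≤ R̂(q, 12, q − 10)` for every `q ≥ 211`. -/
theorem border_k12 (q : ℕ) (hq : 211 ≤ q) : phiK (q + 12) q ≤ rhat q 12 (q - 10) := by
  obtain ⟨m, rfl⟩ : ∃ m, q = m + 2 * 5 := ⟨q - 2 * 5, by omega⟩
  rw [show m + 2 * 5 - 10 = m by omega]
  exact border_even_of_threshold 5 m 211 (by norm_num) (by omega) (by norm_num) (by omega) (by norm_num [Nat.factorial])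

/-- `k = 13`: the borderline `Φ(q+13, q) ≤ R̂(q, 13, q − 11)` for every `q ≥ 156`. -/
theorem border_k13 (q : ℕ) (hq : 156 ≤ q) : phiK (q + 13) q ≤ rhat q 13 (q - 11) := by
  obtain ⟨m, rfl⟩ : ∃ m, q = m + (2 * 5 + 1) := ⟨q - (2 * 5 + 1), by omega⟩
  rw [show m + (2 * 5 + 1) - 11 = m by omega]
  exact border_odd_of_threshold 5 m 156 (by norm_num) (by omega) (by norm_num) (by omega) (by norm_num [Nat.factorial])

/-- `k = 14`: the borderline `Φ(q+14, q) ≤ R̂(q, 14, q − 12)` for every `q ≥ 198`. -/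
theorem border_k14 (q : ℕ) (hq : 198 ≤ q) : phiK (q + 14) q ≤ rhat q 14 (q - 12) := by
  obtain ⟨m, rfl⟩ : ∃ m, q = m + 2 * 6 := ⟨q - 2 * 6, by omega⟩
  rw [show m + 2 * 6 - 12 = m by omega]
  exact border_even_of_threshold 6 m 198 (by norm_num) (by omega) (by norm_num) (by omega) (by norm_num [Nat.factorial])

/-- `k = 15`: the borderline `Φ(q+15, q) ≤ R̂(q, 15, q − 13)` for every `q ≥ 160`. -/
theorem border_k15 (q : ℕ) (hq : 160 ≤ q) : phiK (q + 15) q ≤ rhat q 15 (q - 13) := by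
  obtain ⟨m, rfl⟩ : ∃ m, q = m + (2 * 6 + 1) := ⟨q - (2 * 6 + 1), by omega⟩
  rw [show m + (2 * 6 + 1) - 13 = m by omega]
  exact border_odd_of_threshold 6 m 160 (by norm_num) (by omega) (by norm_num) (by omega) (by norm_num [Nat.factorial])

/-- `k = 16`: the borderline `Φ(q+16, q) ≤ R̂(q, 16, q − 14)` for every `q ≥ 197`. -/
theorem border_k16 (q : ℕ) (hq : 197 ≤ q) : phiK (q + 16) q ≤ rhat q 16 (q - 14) := by
  obtain ⟨m, rfl⟩ : ∃ m, q = m + 2 * 7 := ⟨q - 2 * 7, by omega⟩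
  rw [show m + 2 * 7 - 14 = m by omega]
  exact border_even_of_threshold 7 m 197 (by norm_num) (by omega) (by norm_num) (by omega) (by norm_num [Nat.factorial])

/-- `k = 17`: the borderline `Φ(q+17, q) ≤ R̂(q, 17, q − 15)` for every `q ≥ 167`. -/
theorem border_k17 (q : ℕ) (hq : 167 ≤ q) : phiK (q + 17) q ≤ rhat q 17 (q - 15) := by
  obtain ⟨m, rfl⟩ : ∃ m, q = m + (2 * 7 + 1) := ⟨q - (2 * 7 + 1), by omega⟩
  rw [show m + (2 * 7 + 1) - 15 = m by omega]
  exact border_odd_of_threshold 7 m 167 (by norm_num) (by omega) (by norm_num) (by omega) (by norm_num [Nat.factorial])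

/-- `k = 18`: the borderline `Φ(q+18, q) ≤ R̂(q, 18, q − 16)` for every `q ≥ 200`. -/
theorem border_k18 (q : ℕ) (hq : 200 ≤ q) : phiK (q + 18) q ≤ rhat q 18 (q - 16) := by
  obtain ⟨m, rfl⟩ : ∃ m, q = m + 2 * 8 := ⟨q - 2 * 8, by omega⟩
  rw [show m + 2 * 8 - 16 = m by omega]
  exact border_even_of_threshold 8 m 200 (by norm_num) (by omega) (by norm_num) (by omega) (by norm_num [Nat.factorial])

/-- `k = 19`: the borderline `Φ(q+19, q) ≤ R̂(q, 19, q − 17)` for every `q ≥ 176`. -/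
theorem border_k19 (q : ℕ) (hq : 176 ≤ q) : phiK (q + 19) q ≤ rhat q 19 (q - 17) := by
  obtain ⟨m, rfl⟩ : ∃ m, q = m + (2 * 8 + 1) := ⟨q - (2 * 8 + 1), by omega⟩
  rw [show m + (2 * 8 + 1) - 17 = m by omega]
  exact border_odd_of_threshold 8 m 176 (by norm_num) (by omega) (by norm_num) (by omega) (by norm_num [Nat.factorial])

/-- `k = 20`: the borderline `Φ(q+20, q) ≤ R̂(q, 20, q − 18)` for every `q ≥ 206`. -/
theorem border_k20 (q : ℕ) (hq : 206 ≤ q) : phiK (q + 20) q ≤ rhat q 20 (q - 18) := by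
  obtain ⟨m, rfl⟩ : ∃ m, q = m + 2 * 9 := ⟨q - 2 * 9, by omega⟩
  rw [show m + 2 * 9 - 18 = m by omega]
  exact border_even_of_threshold 9 m 206 (by norm_num) (by omega) (by norm_num) (by omega) (by norm_num [Nat.factorial])

/-- `k = 21`: the borderline `Φ(q+21, q) ≤ R̂(q, 21, q − 19)` for every `q ≥ 189`. -/
theorem border_k21 (q : ℕ) (hq : 189 ≤ q) : phiK (q + 21) q ≤ rhat q 21 (q - 19) := by
  obtain ⟨m, rfl⟩ : ∃ m, q = m + (2 * 9 + 1) := ⟨q - (2 * 9 + 1), by omega⟩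
  rw [show m + (2 * 9 + 1) - 19 = m by omega]
  exact border_odd_of_threshold 9 m 189 (by norm_num) (by omega) (by norm_num) (by omega) (by norm_num [Nat.factorial])

/-- `k = 22`: the borderline `Φ(q+22, q) ≤ R̂(q, 22, q − 20)` for every `q ≥ 214`. -/
theorem border_k22 (q : ℕ) (hq : 214 ≤ q) : phiK (q + 22) q ≤ rhat q 22 (q - 20) := by
  obtain ⟨m, rfl⟩ : ∃ m, q = m + 2 * 10 := ⟨q - 2 * 10, by omega⟩
  rw [show m + 2 * 10 - 20 = m by omega]
  exact border_even_of_threshold 10 m 214 (by norm_num) (by omega) (by norm_num) (by omega) (by norm_num [Nat.factorial])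

/-- **THE MATROID LEVEL OF THE UNIFORM BORDERLINE**: every finite matroid, every cell `(q+k, q)` with `k ≥ 23`, `q ≥ k(k−3)/2`,
every member `Z` of the tight layer with `#(flatPart Z) = q − (k−2)`: `Φ(q+k, q) ≤ recv(Z)`. -/
theorem ruleQRecv_ge_phiK_border_large {β : Type} (M : Matroid β) [M.Finite] {q k : ℕ} (hk : 23 ≤ k)
    (hq : k * (k - 3) ≤ 2 * q) (hE : M.E.ncard = (q + k) + q) {Z : Set β} (hZ : Z ∈ cellMembers M (q + k) q)
    (hP : (flatPart M Z).ncard = q - (k - 2)) :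
    phiK (q + k) q ≤ ruleQRecv M (q + k) q Z := by
  refine le_trans ?_ (rhat_le_ruleQRecv M hE hZ)
  rw [hP]
  exact phiK_le_rhat_border_large k q hk hq

/-- The matroid level for `11 ≤ k ≤ 22`: from the threshold `q₁(k)` of `border_k11 … border_k22`
(stated through the per-`k` hypothesis `hb : phiK (q + k) q ≤ rhat q k (q - (k - 2))`). -/
theorem ruleQRecv_ge_phiK_border_of_rhat {β : Type} (M : Matroid β) [M.Finite] {q k : ℕ}
    (hb : phiK (q + k) q ≤ rhat q k (q - (k - 2))) (hE : M.E.ncard = (q + k) + q) {Z : Set β}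
    (hZ : Z ∈ cellMembers M (q + k) q) (hP : (flatPart M Z).ncard = q - (k - 2)) :
    phiK (q + k) q ≤ ruleQRecv M (q + k) q Z := by
  refine le_trans ?_ (rhat_le_ruleQRecv M hE hZ)
  rw [hP]
  exact hb

end PercRepro
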